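import Mathlib
import HarnessLib

/-!
# Markman's secant object on a principally polarized abelian FOURFOLD ([S] §12): the printed COUNTS, kernel-checked

E. Markman, [S] *Secant sheaves and Weil classes on abelian varieties*, arXiv:2509.23403 **v2** (2026-02-11; §12 was
rewritten in v2 — the v1 §12 names other objects), bib `Markman2025SurveySecant` (published carrier ICM 2026 Proc.,
bib `Markman2026ICMSecant`; the statement below is new in v2 and its status is «yet to be checked» in print —
PREPRINT material). Page/line = PyMuPDF lines of the public v2 PDF (sha256/16 `3151aee3307548da`), read at seat
lit-w-markman (pub-hsemireg LIT-W TABLE row M-Mk10, sheet §23).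

AS PRINTED, v2 p. 21 L57–p. 22 L13: «Consider for example a principally polarized abelian fourfold `(X, Θ)`. Let `d`
be an odd integer `≥ 3`, set `K := ℚ(√−d)`, and set `n := (d + 9)/2`. Let `{D_i : i ∈ ℤ/nℤ}` be `n` generic
translates of the divisor `Θ`, cyclically indexed, such that for every subset `S ⊂ ℤ/nℤ` of cardinality `|S|` the
intersection `∩_{i∈S} D_i` is smooth of codimension `|S|`, if `2 ≤ |S| ≤ 4`, or empty if `|S| ≥ 5`. Set
`Z_i := D_i ∩ D_{i+1}`, `1 ≤ i ≤ n`, and set `Z := ∪_{i=1}^n Z_i`. Note that the intersection `Z_i ∩ Z_j` is a smooth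
curve, if `i − j = ±1` and it consists of `24` points if `i ∉ {j − 1, j, j + 1}`. Let `ν : Z̃ → Z` be the partial
normalization of `Z` along `(d+9)(2d−1)` of its `(d+9)(3d−3)` isolated⁷ points of self intersection. Then the
Chern character of the object `[𝒪_X →^{ν^*} (ν_*𝒪_{Z̃})] ⊗ 𝒪_X(Θ)` belongs to the secant `span{exp(√−dΘ),
exp(−√−dΘ)}`. It is yet to be checked if these secant objects satisfy the weaker criterion in Question 11.4.»;
footnote 7 (p. 22 L73): «The intersection points of `Z_i ∩ Z_j` are isolated, if and only if
`i ∉ {j − 2, j − 1, j, j + 1, j + 2}`.»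

WHAT THIS FILE PROVES (elementary counting only; theorems; 0 named facts): the combinatorics behind the two printed
numbers. With `n` cyclically indexed translates, the ORDERED index pairs `(i, j) ∈ (ℤ/nℤ)²` with
`j − i ∉ {0, ±1, ±2}` — footnote 7's isolation condition — number exactly `n(n − 5)` once `n ≥ 5` (so `n(n−5)/2`
unordered pairs), the pairs with `j − i ∈ {±1, ±2}` number `4n`; and with `24` points per unordered far pair
(«consists of 24 points», `= Θ⁴ = 4!` on a principally polarized fourfold — GEOMETRY, not proved here) the total
`24 · n(n−5)/2 = 12 n (n−5)` equals the printed `(d + 9)(3d − 3)` exactly when `2n = d + 9`, for every odd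
`d ≥ 3`; of these, the printed `(d+9)(2d−1)` are normalized and `(d+9)(d−2)` are not. (A seat class-check of the
Chern-character sentence itself — pub-hsemireg sheet §23 (E3-d), Python ×2 — is NOT reproduced here; nor is
anything about semiregularity or Question 11.4.) HONEST FRAMING: a kernel certificate for the index arithmetic of one
printed example; it re-proves nothing of [S] and asserts nothing geometric.
-/

namespace Literature.AlgebraicGeometry.Markman2025

open Finset

/-! ### The five «near» residues `{0, ±1, ±2} ⊂ ℤ/nℤ` of footnote 7 -/

/-- The residues `{0, 1, −1, 2, −2} ⊂ ℤ/nℤ` — footnote 7's exceptional differences `j − i` (non-isolated or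
non-transversal intersections `Z_i ∩ Z_j`), as the image of the five integers.
[cite: Markman2025SurveySecant, §12 footnote 7, v2 p. 22 L73] -/
def nearResidues (n : ℕ) : Finset (ZMod n) :=
  ({0, 1, -1, 2, -2} : Finset ℤ).image (Int.cast : ℤ → ZMod n)

/-- Integers at distance `< n` apart have distinct residues mod `n`; private helper. [folklore] -/
private theorem intCast_injOn_of_lt {n : ℕ} {a b : ℤ} (h : (b - a).natAbs < n)
    (heq : ((a : ZMod n)) = (b : ZMod n)) : a = b := by
  rw [ZMod.intCast_eq_intCast_iff_dvd_sub] at heq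
  have h0 : b - a = 0 :=
    Int.eq_zero_of_dvd_of_natAbs_lt_natAbs heq (by simpa using h)
  omega

/-- For `n ≥ 5` the five residues `0, ±1, ±2` are pairwise distinct in `ℤ/nℤ`: footnote 7 excludes exactly FIVE
values of `j − i`. [cite: Markman2025SurveySecant, §12 footnote 7, v2 p. 22 L73 (counting content)] -/
theorem card_nearResidues {n : ℕ} (hn : 5 ≤ n) : (nearResidues n).card = 5 := by
  unfold nearResidues
  rw [Finset.card_image_of_injOn]
  · decide
  · intro a ha b hb hab
    simp only [Finset.coe_insert, Finset.coe_singleton, Set.mem_insert_iff, Set.mem_singleton_iff] at ha hb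
    apply intCast_injOn_of_lt (n := n) _ hab
    rcases ha with rfl | rfl | rfl | rfl | rfl <;> rcases hb with rfl | rfl | rfl | rfl | rfl <;> simp <;> omega

/-- Membership in `nearResidues n` unfolded: `x` is one of `0, 1, −1, 2, −2`. [folklore] -/
private theorem mem_nearResidues_iff {n : ℕ} (x : ZMod n) :
    x ∈ nearResidues n ↔ x = 0 ∨ x = 1 ∨ x = -1 ∨ x = 2 ∨ x = -2 := by
  unfold nearResidues
  simp only [Finset.mem_image, Finset.mem_insert, Finset.mem_singleton]
  constructor
  · rintro ⟨k, hk, rfl⟩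
    rcases hk with rfl | rfl | rfl | rfl | rfl <;> simp
  · rintro (rfl | rfl | rfl | rfl | rfl)
    · exact ⟨0, by simp⟩
    · exact ⟨1, by simp⟩
    · exact ⟨-1, by simp⟩
    · exact ⟨2, by simp⟩
    · exact ⟨-2, by simp⟩

/-! ### Ordered index pairs by cyclic distance -/

variable (n : ℕ) [NeZero n]

/-- ORDERED pairs `(i, j) ∈ (ℤ/nℤ)²` with `j − i ∉ {0, ±1, ±2}`: by footnote 7 exactly the pairs for which the points
of `Z_i ∩ Z_j` are ISOLATED self-intersection points of `Z` (and `Z_i ∩ Z_j` «consists of 24 points»).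
[cite: Markman2025SurveySecant, §12, v2 p. 21 L66–67 and footnote 7 p. 22 L73] -/
def farPairs : Finset (ZMod n × ZMod n) :=
  Finset.univ.filter fun p => p.2 - p.1 ∉ nearResidues n

/-- ORDERED pairs `(i, j)` with `j − i ∈ {±1, ±2}`: the intersections `Z_i ∩ Z_j` that are a curve (`±1`) or
non-isolated points (`±2`, footnote 7). [cite: Markman2025SurveySecant, §12, v2 p. 21 L66–67 and footnote 7 p. 22 L73] -/
def nearPairs : Finset (ZMod n × ZMod n) :=
  Finset.univ.filter fun p => p.2 - p.1 ∈ (nearResidues n).erase 0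

/-- **Footnote 7, counted**: for `n ≥ 5` cyclically indexed translates there are exactly `n(n − 5)` ORDERED index
pairs `(i, j)` with `j − i ∉ {0, ±1, ±2}` — hence `n(n−5)/2` unordered pairs `{i, j}` whose `24` intersection points
are isolated self-intersection points of `Z`. (Bijection `(i, j) ↦ (i, j − i)` onto `ℤ/nℤ × (ℤ/nℤ ∖ {0, ±1, ±2})`.)
[cite: Markman2025SurveySecant, §12 footnote 7, v2 p. 22 L73 and p. 22 L3 (counting content)] -/
theorem card_farPairs (hn : 5 ≤ n) : (farPairs n).card = n * (n - 5) := by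
  have hbij : (farPairs n).card =
      ((Finset.univ : Finset (ZMod n)) ×ˢ (Finset.univ \ nearResidues n)).card := by
    apply Finset.card_nbij' (fun p => (p.1, p.2 - p.1)) (fun p => (p.1, p.1 + p.2))
    · intro p hp
      simp only [farPairs, Finset.mem_coe, Finset.mem_filter, Finset.mem_univ, true_and] at hp
      simp only [Finset.mem_coe, Finset.mem_product, Finset.mem_univ, Finset.mem_sdiff, true_and]
      exact hp
    · intro p hp
      simp only [Finset.mem_coe, Finset.mem_product, Finset.mem_univ, Finset.mem_sdiff, true_and] at hp
      simp only [farPairs, Finset.mem_coe, Finset.mem_filter, Finset.mem_univ, true_and, add_sub_cancel_left]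
      exact hp
    · intro p _
      simp
    · intro p _
      simp
  rw [hbij, Finset.card_product, Finset.card_sdiff_of_subset (Finset.subset_univ _), Finset.card_univ,
    ZMod.card, card_nearResidues hn]

/-- For `n ≥ 5` there are exactly `4n` ORDERED pairs `(i, j)` with `j − i ∈ {±1, ±2}` (`2n` with a curve
`Z_i ∩ Z_j`, `2n` with non-isolated points). [cite: Markman2025SurveySecant, §12, v2 p. 21 L66–67 and footnote 7 (counting content)] -/
theorem card_nearPairs (hn : 5 ≤ n) : (nearPairs n).card = 4 * n := by
  have h0 : (0 : ZMod n) ∈ nearResidues n := (mem_nearResidues_iff 0).mpr (Or.inl rfl)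
  have hbij : (nearPairs n).card =
      ((Finset.univ : Finset (ZMod n)) ×ˢ ((nearResidues n).erase 0)).card := by
    apply Finset.card_nbij' (fun p => (p.1, p.2 - p.1)) (fun p => (p.1, p.1 + p.2))
    · intro p hp
      simp only [nearPairs, Finset.mem_coe, Finset.mem_filter, Finset.mem_univ, true_and] at hp
      simp only [Finset.mem_coe, Finset.mem_product, Finset.mem_univ, true_and]
      exact hp
    · intro p hp
      simp only [Finset.mem_coe, Finset.mem_product, Finset.mem_univ, true_and] at hp
      simp only [nearPairs, Finset.mem_coe, Finset.mem_filter, Finset.mem_univ, true_and, add_sub_cancel_left]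
      exact hp
    · intro p _
      simp
    · intro p _
      simp
  rw [hbij, Finset.card_product, Finset.card_erase_of_mem h0, Finset.card_univ, ZMod.card,
    card_nearResidues hn]
  omega

/-- Partition check: off-diagonal ordered pairs `n(n−1) = 4n + n(n−5)` for `n ≥ 5`. [folklore] -/
example (n : ℕ) (hn : 5 ≤ n) : n * (n - 1) = 4 * n + n * (n - 5) := by
  obtain ⟨m, rfl⟩ := Nat.exists_eq_add_of_le hn
  have h1 : 5 + m - 1 = m + 4 := by omega
  have h2 : 5 + m - 5 = m := by omega
  rw [h1, h2]; ring

/-! ### The printed totals `(d+9)(3d−3)` and `(d+9)(2d−1)` -/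

/-- **v2 p. 22 L3 «(d+9)(3d−3) isolated points of self intersection», counted**: for odd `d ≥ 3` and
`n = (d + 9)/2` (an integer `≥ 6`), `24` points on each of the `n(n−5)/2` unordered far pairs give
`12·n·(n − 5) = (d + 9)(3d − 3)` points. (The «24» = `Θ⁴ = 4!` per pair is print's geometric input, footnote-7
isolation is `card_farPairs`; this is the arithmetic joining them.)
[cite: Markman2025SurveySecant, §12, v2 p. 21 L60 («n := (d + 9)/2») and p. 22 L3] -/
theorem isolatedPoints_count {d : ℕ} (hd : Odd d) (h3 : 3 ≤ d) :
    12 * ((d + 9) / 2) * ((d + 9) / 2 - 5) = (d + 9) * (3 * d - 3) := by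
  obtain ⟨k, rfl⟩ := hd
  have hk : 1 ≤ k := by omega
  have hn : (2 * k + 1 + 9) / 2 = k + 5 := by omega
  have h5 : k + 5 - 5 = k := by omega
  have h6 : 3 * (2 * k + 1) - 3 = 6 * k := by omega
  rw [hn, h5, h6]
  ring

/-- The same identity with `n` explicit: `2n = d + 9` ⟹ `24 · (n(n−5)/2) = 12 n (n−5) = (d+9)(3d−3)` (`n ≥ 5`,
so `n(n − 5)` is even-or-odd but `24·⌊n(n−5)/2⌋` would be wrong for odd `n(n−5)` — it is always even: one of
`n`, `n − 5` is even). [cite: Markman2025SurveySecant, §12, v2 p. 21 L60 and p. 22 L3 (counting content)] -/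
theorem isolatedPoints_count' {d n : ℕ} (h : 2 * n = d + 9) (hn : 5 ≤ n) :
    24 * (n * (n - 5) / 2) = (d + 9) * (3 * d - 3) := by
  obtain ⟨m, rfl⟩ := Nat.exists_eq_add_of_le hn
  have hd : d = 2 * m + 1 := by omega
  subst hd
  have h5 : 5 + m - 5 = m := by omega
  have h6 : 3 * (2 * m + 1) - 3 = 6 * m := by omega
  have heven : (5 + m) * m / 2 * 2 = (5 + m) * m := by
    have : Even ((5 + m) * m) := by
      rcases Nat.even_or_odd m with hm | hm
      · exact hm.mul_left _
      · have : Even (5 + m) := by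
          rcases hm with ⟨j, rfl⟩; exact ⟨j + 3, by ring⟩
        exact this.mul_right _
    exact Nat.div_two_mul_two_of_even this
  rw [h5, h6]
  have : 24 * ((5 + m) * m / 2) = 12 * ((5 + m) * m / 2 * 2) := by ring
  rw [this, heven]
  ring

/-- **v2 p. 22 L3 «the partial normalization of Z along (d+9)(2d−1) of its (d+9)(3d−3) isolated points»**: the
normalized points plus the `(d+9)(d−2)` left un-normalized make up the total, for every `d ≥ 2` (in particular the
printed count is consistent: `(d+9)(2d−1) ≤ (d+9)(3d−3)`). [cite: Markman2025SurveySecant, §12, v2 p. 22 L3] -/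
theorem normalizedPoints_add_rest {d : ℕ} (h2 : 2 ≤ d) :
    (d + 9) * (2 * d - 1) + (d + 9) * (d - 2) = (d + 9) * (3 * d - 3) := by
  obtain ⟨m, rfl⟩ := Nat.exists_eq_add_of_le h2
  have h1 : 2 * (2 + m) - 1 = 2 * m + 3 := by omega
  have h2' : 2 + m - 2 = m := by omega
  have h3 : 3 * (2 + m) - 3 = 3 * m + 3 := by omega
  rw [h1, h2', h3]; ring

/-- Consequence: the printed number of normalized points never exceeds the number of isolated points (`d ≥ 2`).
[cite: Markman2025SurveySecant, §12, v2 p. 22 L3] -/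
theorem normalizedPoints_le {d : ℕ} (h2 : 2 ≤ d) : (d + 9) * (2 * d - 1) ≤ (d + 9) * (3 * d - 3) := by
  rw [← normalizedPoints_add_rest h2]; exact Nat.le_add_right _ _

/-! ### Numerals at the first admissible values `d = 3, 5, 7` (`n = 6, 7, 8`) -/

/-- `d = 3` (`K = ℚ(√−3)`, `n = 6` translates): `6·1 = 6` ordered far pairs per footnote 7 … i.e. `3` unordered,
`72 = 12·6·1 = (3+9)(9−3)` isolated points, `60 = 12·5` normalized, `12` left.
[cite: Markman2025SurveySecant, §12, v2 p. 21 L58–60 and p. 22 L3 (instance d = 3)] -/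
theorem count_d_three : 12 * 6 * (6 - 5) = (3 + 9) * (3 * 3 - 3) ∧ (3 + 9) * (3 * 3 - 3) = 72 ∧
    (3 + 9) * (2 * 3 - 1) = 60 ∧ (3 + 9) * (3 - 2) = 12 := by decide

example : (farPairs 6).card = 6 * (6 - 5) := card_farPairs 6 (by norm_num)
example : (nearPairs 6).card = 4 * 6 := card_nearPairs 6 (by norm_num)
example : 12 * 7 * (7 - 5) = (5 + 9) * (3 * 5 - 3) ∧ (5 + 9) * (3 * 5 - 3) = 168 ∧ (5 + 9) * (2 * 5 - 1) = 126 := by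
  decide
example : 12 * 8 * (8 - 5) = (7 + 9) * (3 * 7 - 3) ∧ (7 + 9) * (3 * 7 - 3) = 288 ∧ (7 + 9) * (2 * 7 - 1) = 208 := by
  decide

end Literature.AlgebraicGeometry.Markman2025
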